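import Literature.NumberTheory.Rogawski1990.LocalTransferCentralSingularJunctionCM          -- ★ p841395 (F0P2-p02): carriers, `isUnit_eval_finCharpolyTwo_of_central`
import Literature.NumberTheory.Rogawski1990.FinExplicitTransferFactorEventuallyConst        -- ★ `finTau_eventually_eq`, `finWeylRatio_eventually_eq`
import Literature.NumberTheory.Rogawski1990.FinExplicitTransferFactorNondegenerate          -- ★ `isUnit_eval_finCharpolyTwo_of_isLocalGRegular`
import Literature.NumberTheory.Rogawski1990.FinExplicitTransferFactorInertPlace             -- ★ `finKappaAt_eq_ite_of_eigenvector`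
import Literature.NumberTheory.Rogawski1990.EndoscopicClassTransfer                         -- ★ `EndoMatches.of_isStablyConjH_left`
import Literature.NumberTheory.Rogawski1990.LocalNormFibreNonsplit                          -- ★ `IsLocalStablyConjH.finGammaTwo_eq`
import HarnessLib

/-!
# `Δ‴_v` IS CONSTANT ALONG THE CENTRAL DOCK ON STABLE CLASSES NEAR `ε_H` — the binder `hΔθ` of the (R-inv) central singular junction

Topic `NumberTheory/Rogawski1990`; namespace `Literature.NumberTheory.Rogawski1990`.  THEOREMS ONLY (no definition, no instance, no notation, no named
fact, no `sorry`).  Cell `pub/hodgecm-mathlib` (D-0151), crux H413 = stmt-HodgeConjecture-24833, floor-2 line «N6nsGerm» (stub `stub_N6nsS1`); LEAD F0P3a-plan (g9)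
WORD T8-83 (1) ∕ T8-86 (3), p08 (g13) 06:04:07Z «unowned: `hΔθ`»; seat F0P3-p01 (g12).  HONEST LABEL: HC_CM is proved only modulo the printed citations until rung 0
closes; this file discharges ONE HYPOTHESIS of ★ `exists_nhds_stableOrbitalIntegralRel_eq_of_central_singular_inv` (p08 (g13) c7908dea :114–:117), nothing printed.

THE MATHEMATICS.  Let `ε_H = (a·1₂, u) ∈ H_v = U(Φ₂)_v × U(Φ₁)_v` (`u ≠ a`, one place `w ∣ v`), `θ : H_v ≃ Z_{G′_v}(ε)` the central dock with `θ z = y·ι_v(z)·y⁻¹`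
(as matrices) and `y·ι_v(ε_H)·y⁻¹ = ε`.  Rogawski's explicit factor is `Δ‴_v(γ_H, γ′) = τ_v(γ_H)·D_{G∕H,v}(γ_H)·κ_v(γ_H, γ′)` on matching pairs (★ `finExplicitDelta_of_isLocalNormPair`).
For `γ_H` near `ε_H` and `h` stably conjugate to `γ_H`:
* `(γ_H, θ h)` is a matching pair — `θ h = y ι(h) y⁻¹` is `GL₃`-conjugate to `ι(h)`, and matching only sees the stable class of `γ_H` (★ `EndoMatches.of_isStablyConjH_left`);
* `τ_v(γ_H) = τ_v(ε_H)`, `D(γ_H) = D(ε_H)` near `ε_H` (★ `finTau_eventually_eq`, ★ `finWeylRatio_eventually_eq`; `χ_{a·1₂}(u) = (u − a)²` is a unit, ★ `isUnit_eval_finCharpolyTwo_of_central`);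
* `κ_v(γ_H, θ h) = κ_v(ε_H, ε)`: EVERY `θ h` has the common `u(h)`-eigenvector `y·e₂` (the middle column of `y`; `ι(h) e₂ = u(h) e₂` for the pattern `(* 0 *; 0 u 0; * 0 *)`), and `u(h) = u(γ_H)`
  for stably conjugate `h` (★ `IsLocalStablyConjH.finGammaTwo_eq`); by ★ `finKappaAt_eq_ite_of_eigenvector` the sign `κ_v` is read on that fixed vector against `H′_v` — the same
  reading at `(γ_H, θ h)` and at `(ε_H, ε = y ι(ε_H) y⁻¹)`.
Hence `Δ‴_v(γ_H, θ h) = Δ‴_v(ε_H, ε)`. [Rogawski1990 §4.9 p. 55 (the factor), §4.3 (4.3.2) p. 43 (κ on the eigenline), Prop. 8.1.3 proof p. 116 (local constancy), §8.2 Prop. 8.2.1 (a) p. 112.]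

## References
* [Rogawski1990] J. Rogawski, *Automorphic Representations of Unitary Groups in Three Variables*, Ann. of Math. Stud. 123 (1990): §4.3 p. 43; §4.9 pp. 54–55; §8.1 Prop. 8.1.3 p. 116; §8.2 Prop. 8.2.1 p. 112.
* [LanglandsShelstad1987] R. P. Langlands, D. Shelstad, *On the definition of transfer factors*, Math. Ann. 278 (1987): §1 (κ via `inv(γ_H, γ)`).
-/

set_option autoImplicit false

noncomputable section

open Set Filter Topology Polynomial
open scoped Matrix

namespace Literature.NumberTheory.Rogawski1990

open Literature.NumberTheory.Automorphic Literature.NumberTheory.Automorphic.UnitaryGroup Literature.NumberTheory.GaloisRepresentations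
open _root_.NumberField _root_.IsDedekindDomain _root_.Matrix

section DockConstancy

variable (L : Type) [Field L] [NumberField L] [IsCMField L] (H' : Matrix (Fin 3) (Fin 3) L) (v : HeightOneSpectrum (𝓞 ↥(maximalRealSubfield L)))

/-! ## §1 Linear-algebra bookkeeping -/

omit [IsCMField L] in
/-- `E = ∏_{w∣v} L_w` is non-trivial (there is a place above `v`). [folklore] -/
private theorem nontrivial_localRing' : Nontrivial (LocalRing L v) := by
  obtain ⟨w⟩ := (inferInstance : Nonempty (PlacesOver L v))
  exact ⟨⟨0, 1, fun h => zero_ne_one (congrFun h w)⟩⟩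

/-- A conjugate `γ′` with `g γ = γ′ g` has the eigenvector `g p` when `γ` has the eigenvector `p`. [folklore] -/
private theorem conj_mulVec_mulVec_eq_smul' {n : Type} [Fintype n] {R : Type} [CommRing R] {γ γ' g : Matrix n n R} (hg : g * γ = γ' * g)
    {u : R} {p : n → R} (hp : γ *ᵥ p = u • p) : γ' *ᵥ (g *ᵥ p) = u • (g *ᵥ p) := by
  rw [mulVec_mulVec, ← hg, ← mulVec_mulVec, hp, mulVec_smul]

/-- An invertible matrix kills no non-zero vector. [folklore] -/
private theorem mulVec_ne_zero_of_ne_zero' {n : Type} [Fintype n] [DecidableEq n] {R : Type} [CommRing R] (g : GL n R) {p : n → R} (hp : p ≠ 0) :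
    g.val *ᵥ p ≠ 0 := by
  intro h0
  apply hp
  have h1 : (g⁻¹).val *ᵥ (g.val *ᵥ p) = p := by
    rw [mulVec_mulVec, ← Units.val_mul, inv_mul_cancel, Units.val_one, one_mulVec]
  rw [← h1, h0, mulVec_zero]

/-- `g b g⁻¹ = b′` in `GL` gives `g·b = b′·g` on matrices. [folklore] -/
private theorem val_mul_val_eq_of_conj_eq {n : Type} [Fintype n] [DecidableEq n] {R : Type} [CommRing R] {g b b' : GL n R} (hg : g * b * g⁻¹ = b') :
    g.val * b.val = b'.val * g.val := by
  have h : g * b = b' * g := by rw [← hg, inv_mul_cancel_right]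
  rw [← Units.val_mul, h, Units.val_mul]

/-- **`ι_v(g₂, u)` has the middle basis vector as a `u`-eigenvector**: `ι(h) e₂ = u(h) e₂` for the pattern `(* 0 *; 0 u 0; * 0 *)`.
[cite: Rogawski1990, §4.8 Case (a) p. 53] -/
theorem endoEmbLocal_mulVec_single_one
    (h : (cmDatum L 2 (Matrix.of fun i j : Fin 2 => if i.val + j.val + 1 = 2 then (1 : L) else 0)).Local v ×
      (cmDatum L 1 (Matrix.of fun i j : Fin 1 => if i.val + j.val + 1 = 1 then (1 : L) else 0)).Local v) :
    (((endoEmbLocal L v h).val : GL (Fin 3) (LocalRing L v)).val : Matrix (Fin 3) (Fin 3) (LocalRing L v)) *ᵥ Pi.single 1 1 =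
      finGammaTwo L v h • Pi.single 1 1 := by
  rw [coe_endoEmbLocal, coe_endoGL_eq]
  ext i
  fin_cases i <;> simp [Matrix.mulVec, dotProduct, Pi.single_apply, finGammaTwo]

/-! ## §2 Matching and `κ_v` along the dock -/

variable {L H' v}

/-- **Every docked element matches its source**: `ι_v(h) ↔ θ h` when `θ h = y·ι(h)·y⁻¹` (matching = `GL₃`-conjugacy of `ι_v(γ_H)` with `γ′`).
[cite: Rogawski1990, §4.9 p. 54; §14.1 p. 232] -/
theorem isLocalNormPair_of_val_eq_conj
    {h : (cmDatum L 2 (Matrix.of fun i j : Fin 2 => if i.val + j.val + 1 = 2 then (1 : L) else 0)).Local v ×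
      (cmDatum L 1 (Matrix.of fun i j : Fin 1 => if i.val + j.val + 1 = 1 then (1 : L) else 0)).Local v}
    {b : (cmDatum L 3 H').Local v} {y : GL (Fin 3) (LocalRing L v)}
    (hb : (b.val : GL (Fin 3) (LocalRing L v)) = y * ((endoEmbLocal L v h).val : GL (Fin 3) (LocalRing L v)) * y⁻¹) :
    IsLocalNormPair L H' v h b :=
  isConj_iff.2 ⟨y, hb.symm⟩

/-- **Matching along the dock only sees the stable class**: `γ_H ∼_st h` and `θ h = y ι(h) y⁻¹` give `ι_v(γ_H) ↔ θ h`.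
[cite: Rogawski1990, §14.1 p. 232; §3.1 p. 19] -/
theorem isLocalNormPair_of_isLocalStablyConjH_of_val_eq_conj
    {γH h : (cmDatum L 2 (Matrix.of fun i j : Fin 2 => if i.val + j.val + 1 = 2 then (1 : L) else 0)).Local v ×
      (cmDatum L 1 (Matrix.of fun i j : Fin 1 => if i.val + j.val + 1 = 1 then (1 : L) else 0)).Local v}
    (hst : IsLocalStablyConjH L v γH h)
    {b : (cmDatum L 3 H').Local v} {y : GL (Fin 3) (LocalRing L v)}
    (hb : (b.val : GL (Fin 3) (LocalRing L v)) = y * ((endoEmbLocal L v h).val : GL (Fin 3) (LocalRing L v)) * y⁻¹) :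
    IsLocalNormPair L H' v γH b :=
  (isLocalNormPair_of_val_eq_conj hb).of_isStablyConjH_left hst.symm

open scoped Classical in
/-- **`κ_v` ALONG THE DOCK IS READ ON THE FIXED VECTOR `y·e₂`** (non-split `v`): for `γ_H ∼_st h`, `χ_g(u)` a unit at `γ_H`, and `b = y ι(h) y⁻¹ ∈ G′_v`,
`κ_v(γ_H, b) = +1` iff `⟨y e₂, y e₂⟩_{H′_v}` is a unit norm — independent of `h` and of `γ_H`. [cite: Rogawski1990, §4.3 (4.3.2) p. 43; §3.5 Prop. 3.5.2 (c) p. 29]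
[cite: LanglandsShelstad1987, §1] -/
theorem finKappaAt_eq_ite_of_val_eq_conj (hv : Subsingleton (PlacesOver L v))
    {γH h : (cmDatum L 2 (Matrix.of fun i j : Fin 2 => if i.val + j.val + 1 = 2 then (1 : L) else 0)).Local v ×
      (cmDatum L 1 (Matrix.of fun i j : Fin 1 => if i.val + j.val + 1 = 1 then (1 : L) else 0)).Local v}
    (hst : IsLocalStablyConjH L v γH h) (hu : IsUnit ((finCharpolyTwo L v γH).eval (finGammaTwo L v γH)))
    {b : (cmDatum L 3 H').Local v} {y : GL (Fin 3) (LocalRing L v)}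
    (hb : (b.val : GL (Fin 3) (LocalRing L v)) = y * ((endoEmbLocal L v h).val : GL (Fin 3) (LocalRing L v)) * y⁻¹) :
    finKappaAt L v H' γH b =
      if ∃ z : LocalRing L v, IsUnit z ∧
          (∑ i : Fin 3, ∑ k : Fin 3, conjLocal L (IsCMField.complexConj L) v ((y.val *ᵥ Pi.single 1 1) i) *
            ((adelicForm L 3 H').map (adeleToLocal L v)) i k * (y.val *ᵥ Pi.single 1 1) k) =
          z * conjLocal L (IsCMField.complexConj L) v z
      then 1 else -1 := by
  haveI := nontrivial_localRing' L v
  have hmatch : IsLocalNormPair L H' v γH b := isLocalNormPair_of_isLocalStablyConjH_of_val_eq_conj hst hb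
  -- `y·ι(h) = b·y` on matrices
  have hgm : y.val * (((endoEmbLocal L v h).val : GL (Fin 3) (LocalRing L v)).val : Matrix (Fin 3) (Fin 3) (LocalRing L v)) =
      (b.val.val : Matrix (Fin 3) (Fin 3) (LocalRing L v)) * y.val :=
    val_mul_val_eq_of_conj_eq (g := y) (b := ((endoEmbLocal L v h).val : GL (Fin 3) (LocalRing L v))) (b' := (b.val : GL (Fin 3) (LocalRing L v))) hb.symm
  -- the common eigenvector `y e₂`, eigenvalue `u(h) = u(γ_H)`
  have hp : (b.val.val : Matrix (Fin 3) (Fin 3) (LocalRing L v)) *ᵥ (y.val *ᵥ Pi.single 1 1) = finGammaTwo L v γH • (y.val *ᵥ Pi.single 1 1) := by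
    rw [hst.finGammaTwo_eq]
    exact conj_mulVec_mulVec_eq_smul' hgm (endoEmbLocal_mulVec_single_one L v h)
  have hne : y.val *ᵥ (Pi.single 1 1 : Fin 3 → LocalRing L v) ≠ 0 :=
    mulVec_ne_zero_of_ne_zero' y (by simp)
  exact finKappaAt_eq_ite_of_eigenvector L v H' γH b hv hmatch hu hp hne

/-! ## §3 The binder `hΔθ` -/

/-- **`Δ‴_v` IS CONSTANT ALONG THE CENTRAL DOCK ON STABLE CLASSES NEAR `ε_H`** — the binder `hΔθ` of ★
`exists_nhds_stableOrbitalIntegralRel_eq_of_central_singular_inv` VERBATIM: for the central `(G,H)`-regular `ε_H = (a·1₂, u)` (`u ≠ a`) at a non-split `v`, the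
dock `θ : H_v ≃ₜ* Z_{G′_v}(ε)` with `θ z = y·ι_v(z)·y⁻¹` and `y·ι_v(ε_H)·y⁻¹ = ε`, there is a neighbourhood `VΔ ∋ ε_H` such that for every `G`-regular `γ_H ∈ VΔ` and
every `h ∼_st γ_H`, `Δ‴_v(γ_H, θ h) = Δ‴_v(ε_H, ε)`.  Proof: `Δ‴ = τ·D·κ` on matching pairs; `τ, D` are eventually constant at `ε_H` (`χ_{a·1₂}(u)` a unit); `κ` is read on the
fixed vector `y e₂` on both sides. [cite: Rogawski1990, §4.9 p. 55; §4.3 (4.3.2) p. 43; §8.1 Prop. 8.1.3 proof p. 116; §8.2 Prop. 8.2.1 (a) p. 112] [cite: LanglandsShelstad1987, §1] -/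
theorem exists_nhds_finExplicitDelta_dock_eq (w : PlacesOver L v) (hw : IsCMField.complexConj L • w.1 = w.1) (μ : HeckeCharacter L)
    (εH : ((cmDatum L 2 (Matrix.of fun i j : Fin 2 => if i.val + j.val + 1 = 2 then (1 : L) else 0)).Local v ×
      (cmDatum L 1 (Matrix.of fun i j : Fin 1 => if i.val + j.val + 1 = 1 then (1 : L) else 0)).Local v)) (a : LocalRing L v)
    (ha : (εH.1.val.val : Matrix (Fin 2) (Fin 2) (LocalRing L v)) = a • (1 : Matrix (Fin 2) (Fin 2) (LocalRing L v)))
    (hu : (εH.2.val.val : Matrix (Fin 1) (Fin 1) (LocalRing L v)) 0 0 ≠ a)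
    (ε : (cmDatum L 3 H').Local v) (y : GL (Fin 3) (LocalRing L v))
    (θ : ((cmDatum L 2 (Matrix.of fun i j : Fin 2 => if i.val + j.val + 1 = 2 then (1 : L) else 0)).Local v ×
      (cmDatum L 1 (Matrix.of fun i j : Fin 1 => if i.val + j.val + 1 = 1 then (1 : L) else 0)).Local v) ≃ₜ* ↥(Subgroup.centralizer ({ε} : Set ((cmDatum L 3 H').Local v))))
    (hy : y * ((endoEmbLocal L v εH).val : GL (Fin 3) (LocalRing L v)) * y⁻¹ = ε.val)
    (hθ : ∀ z : ((cmDatum L 2 (Matrix.of fun i j : Fin 2 => if i.val + j.val + 1 = 2 then (1 : L) else 0)).Local v ×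
      (cmDatum L 1 (Matrix.of fun i j : Fin 1 => if i.val + j.val + 1 = 1 then (1 : L) else 0)).Local v), (((θ z).1).val : GL (Fin 3) (LocalRing L v)) = y * ((endoEmbLocal L v z).val : GL (Fin 3) (LocalRing L v)) * y⁻¹) :
    ∃ VΔ ∈ 𝓝 εH, ∀ γH ∈ VΔ, IsLocalGRegular L v γH → ∀ h : ((cmDatum L 2 (Matrix.of fun i j : Fin 2 => if i.val + j.val + 1 = 2 then (1 : L) else 0)).Local v ×
      (cmDatum L 1 (Matrix.of fun i j : Fin 1 => if i.val + j.val + 1 = 1 then (1 : L) else 0)).Local v), IsLocalStablyConjH L v γH h →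
      finExplicitDelta L v H' γH μ ((θ h : ↥(Subgroup.centralizer ({ε} : Set ((cmDatum L 3 H').Local v)))) : (cmDatum L 3 H').Local v) = finExplicitDelta L v H' εH μ ε := by
  classical
  haveI hv : Subsingleton (PlacesOver L v) := PlacesOver.subsingleton_of_smul_eq (IsCMField.complexConj L) (IsCMField.complexConj_ne_one L) w hw
  have hu₀ : IsUnit ((finCharpolyTwo L v εH).eval (finGammaTwo L v εH)) := isUnit_eval_finCharpolyTwo_of_central L v w hw εH a ha hu
  -- `τ`, `D` eventually constant at `ε_H`
  obtain ⟨VΔ, hVΔ, hV⟩ := ((finTau_eventually_eq L v μ hu₀).and (finWeylRatio_eventually_eq L v hu₀)).exists_mem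
  refine ⟨VΔ, hVΔ, fun γH hγ hreg h hst => ?_⟩
  obtain ⟨hτ, hD⟩ := hV γH hγ
  -- both pairs match
  have hbθ : (((θ h : ↥(Subgroup.centralizer ({ε} : Set ((cmDatum L 3 H').Local v)))) : (cmDatum L 3 H').Local v).val : GL (Fin 3) (LocalRing L v)) =
      y * ((endoEmbLocal L v h).val : GL (Fin 3) (LocalRing L v)) * y⁻¹ := hθ h
  have hbε : (ε.val : GL (Fin 3) (LocalRing L v)) = y * ((endoEmbLocal L v εH).val : GL (Fin 3) (LocalRing L v)) * y⁻¹ := hy.symm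
  have hmθ : IsLocalNormPair L H' v γH ((θ h : ↥(Subgroup.centralizer ({ε} : Set ((cmDatum L 3 H').Local v)))) : (cmDatum L 3 H').Local v) :=
    isLocalNormPair_of_isLocalStablyConjH_of_val_eq_conj hst hbθ
  have hmε : IsLocalNormPair L H' v εH ε := isLocalNormPair_of_val_eq_conj hbε
  -- `κ` on the fixed vector, both sides
  have hκθ := finKappaAt_eq_ite_of_val_eq_conj (H' := H') hv hst (isUnit_eval_finCharpolyTwo_of_isLocalGRegular (L := L) (v := v) (a := γH) hreg) hbθ
  have hκε := finKappaAt_eq_ite_of_val_eq_conj (H' := H') hv (IsStablyConjH.refl _ _ _ εH) hu₀ hbε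
  rw [finExplicitDelta_of_isLocalNormPair L v H' γH μ hmθ, finExplicitDelta_of_isLocalNormPair L v H' εH μ hmε, hτ, hD, hκθ, hκε]

end DockConstancy

end Literature.NumberTheory.Rogawski1990

end
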